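import Mathlib
import Literature.Analysis.UnboundedOperators.ConjugateOperatorRegularity
import Literature.Analysis.UnboundedOperators.UnitaryRepSpectralMeasure
import Literature.Analysis.UnboundedOperators.FourierSpectrumCalculus
import HarnessLib
import Summits.AtomisticToContinuum.FouriersLaw.Theorems.EmbeddedDrudeMourreMourreDissolutionLAPFunctionalCalculus

/-!
# Stub `stub_mourreThresholdLAP` — Mourre LAP infrastructure 14: symbols of the smeared group algebra I

Item `stmt-AtomisticToContinuum-12594` (crux `MourreDissolution` of route `EmbeddedDrudeMourre`,
sub-problem `FouriersLaw`), line `separable-vertex-faddeev-pair-sector`, stub S6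
`stub_mourreThresholdLAP` (Mourre's limiting absorption principle; NOT in the tree). Fourth step of
L3 of the proof map (route (b)): the spectral-theorem-free "symbol calculus" identifying bounded
functions of `H` built from the group `U(t) = e^{itH}` through their spectral side. An operator
`B = c·1 + U[k]` (`U[k] = ∫ k(a) U(a) da`, `k ∈ L¹`) HAS SYMBOL `b = c + ǩ`, `ǩ(ξ) = ∫ k(a) e^{iξa} da`:

* §1 `⟪ψ, U[k] ψ⟫ = ∫ ǩ dμ_ψ` (Stone–Bochner measure `specMeasure U ψ`, Fubini) and the convolution
  theorem `(k₁ ⋆ k₂)ˇ = ǩ₁ ǩ₂` (Fubini + translation invariance);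
* §2 the data `d = (c, k)` (`SymbolDatum`, a Type — no predicate is introduced) carry the operator
  `d.op U = c·1 + U[k]` and the symbol `d.fn = c + ǩ`; they form a unital algebra (`one`, `add`,
  `smul`, `mul` via `U[k₁] U[k₂] = U[k₁ ⋆ k₂]`, `pow`) with `op`/`fn` multiplicative, `⟪v, d.op v⟫ =
  ∫ d.fn dμ_v`, and `d.fn` continuous and bounded;
* headline `inner_smearAlgebra_eq_integral_symbol`: `⟪v, (c·1 + U[k]) v⟫ = ∫ (c + ǩ) dμ_v`.

Exponentials (`⟪v, e^{iτB} v⟫ = ∫ e^{iτ b} dμ_v`) and the resolvent data are in `…LAPSymbolExp`.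
-/

noncomputable section

open MeasureTheory Complex Filter Topology Set
open scoped InnerProductSpace ComplexConjugate SchwartzMap FourierTransform ENNReal NNReal Nat

namespace Summit.AtomisticToContinuum.FouriersLaw.Theorems.MourreDissolution

open Literature.Analysis.UnboundedOperators
open Literature.Analysis.UnboundedOperators.UnitaryRep

variable {H : Type*} [NormedAddCommGroup H] [InnerProductSpace ℂ H] [CompleteSpace H]

/-! ## §1. The symbol `ǩ(ξ) = ∫ k(a) e^{iξa} da` of an integrable kernel -/

/-- **The symbol of a kernel**: `kernelSymbol k ξ = ǩ(ξ) = ∫ k(a) e^{iξa} da` (so that `U[k]` acts as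
multiplication by `ǩ` on the spectral side). [folklore] -/
def kernelSymbol (k : ℝ → ℂ) (ξ : ℝ) : ℂ := ∫ a, k a * cexp (((ξ * a : ℝ) : ℂ) * I)

/-- `|e^{iξa}| = 1`. [folklore] -/
theorem norm_cexp_real_mul_I (r : ℝ) : ‖cexp ((r : ℂ) * I)‖ = 1 := by
  rw [Complex.norm_exp]
  simp

/-- The integrand `k(a) e^{iξa}` is integrable. [folklore] -/
theorem integrable_mul_cexp {k : ℝ → ℂ} (hk : Integrable k) (ξ : ℝ) :
    Integrable fun a : ℝ => k a * cexp (((ξ * a : ℝ) : ℂ) * I) := by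
  refine hk.norm.mono' (hk.aestronglyMeasurable.mul (Continuous.aestronglyMeasurable (by fun_prop)))
    (ae_of_all _ fun a => ?_)
  rw [norm_mul, norm_cexp_real_mul_I, mul_one]

/-- `‖ǩ(ξ)‖ ≤ ‖k‖₁`. [folklore] -/
theorem norm_kernelSymbol_le (k : ℝ → ℂ) (ξ : ℝ) : ‖kernelSymbol k ξ‖ ≤ ∫ a, ‖k a‖ := by
  refine (norm_integral_le_integral_norm _).trans (le_of_eq ?_)
  congr 1
  funext a
  rw [norm_mul, norm_cexp_real_mul_I, mul_one]

/-- `ǩ` is continuous (dominated convergence). [folklore] -/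
theorem continuous_kernelSymbol {k : ℝ → ℂ} (hk : Integrable k) : Continuous (kernelSymbol k) := by
  refine continuous_of_dominated (F := fun ξ a => k a * cexp (((ξ * a : ℝ) : ℂ) * I))
    (bound := fun a => ‖k a‖) (fun ξ => (integrable_mul_cexp hk ξ).aestronglyMeasurable)
    (fun ξ => ae_of_all _ fun a => ?_) hk.norm (ae_of_all _ fun a => ?_)
  · rw [norm_mul, norm_cexp_real_mul_I, mul_one]
  · fun_prop

/-- `ǩ` is additive in the kernel. [folklore] -/
theorem kernelSymbol_add {k₁ k₂ : ℝ → ℂ} (hk₁ : Integrable k₁) (hk₂ : Integrable k₂) (ξ : ℝ) :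
    kernelSymbol (fun a => k₁ a + k₂ a) ξ = kernelSymbol k₁ ξ + kernelSymbol k₂ ξ := by
  unfold kernelSymbol
  rw [← integral_add (integrable_mul_cexp hk₁ ξ) (integrable_mul_cexp hk₂ ξ)]
  simp_rw [add_mul]

/-- `ǩ` is homogeneous in the kernel. [folklore] -/
theorem kernelSymbol_smul (c : ℂ) (k : ℝ → ℂ) (ξ : ℝ) :
    kernelSymbol (fun a => c * k a) ξ = c * kernelSymbol k ξ := by
  unfold kernelSymbol
  rw [← integral_const_mul]
  simp_rw [mul_assoc]

/-- The symbol of the zero kernel vanishes. [folklore] -/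
@[simp] theorem kernelSymbol_zero (ξ : ℝ) : kernelSymbol (0 : ℝ → ℂ) ξ = 0 := by
  simp [kernelSymbol]

/-- **Spectral side of a smeared operator**: `⟪ψ, U[k] ψ⟫ = ∫ ǩ(ξ) dμ_ψ(ξ)` (Fubini over the
Stone–Bochner measure). [folklore] -/
theorem inner_smear_eq_integral_specMeasure (U : OneParameterUnitaryGroup H) {k : ℝ → ℂ}
    (hk : Integrable k) (ψ : H) :
    ⟪ψ, U.smear k ψ⟫_ℂ = ∫ ξ, kernelSymbol k ξ ∂(specMeasure U ψ) := by
  -- adapted from `inner_fourierCalculus_eq_integral_specMeasure` (part 3)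
  rw [U.smear_apply hk, inner_integral_smul_appReal U hk]
  have hint : Integrable (Function.uncurry fun (a ξ : ℝ) => k a * cexp (((ξ * a : ℝ) : ℂ) * I))
      ((volume : Measure ℝ).prod (specMeasure U ψ)) := by
    have h1 : Integrable (fun z : ℝ × ℝ => ‖k z.1‖ * (1 : ℝ))
        ((volume : Measure ℝ).prod (specMeasure U ψ)) := (hk.norm).mul_prod (integrable_const _)
    refine h1.mono' (hk.aestronglyMeasurable.comp_fst.mul (Continuous.aestronglyMeasurable ?_))
      (ae_of_all _ fun z => ?_)
    · fun_prop
    · change ‖k z.1 * cexp (((z.2 * z.1 : ℝ) : ℂ) * I)‖ ≤ ‖k z.1‖ * 1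
      rw [norm_mul, norm_cexp_real_mul_I]
  calc ∫ a, k a * ⟪ψ, U.appReal a ψ⟫_ℂ
      = ∫ a, ∫ ξ, k a * cexp (((ξ * a : ℝ) : ℂ) * I) ∂(specMeasure U ψ) := by
        refine integral_congr_ae (ae_of_all _ fun a => ?_)
        simp only
        rw [inner_appReal_eq_integral_specMeasure, ← integral_const_mul]
    _ = ∫ ξ, (∫ a, k a * cexp (((ξ * a : ℝ) : ℂ) * I)) ∂(specMeasure U ψ) :=
        integral_integral_swap hint

/-- **Convolution theorem for symbols**: `(k₁ ⋆ k₂)ˇ(ξ) = ǩ₁(ξ) ǩ₂(ξ)` (Fubini and the translation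
invariance of Lebesgue measure). [folklore] -/
theorem kernelSymbol_convolution {k₁ k₂ : ℝ → ℂ} (hk₁ : Integrable k₁) (hk₂ : Integrable k₂) (ξ : ℝ) :
    kernelSymbol (fun s => ∫ t, k₁ t * k₂ (s - t)) ξ = kernelSymbol k₁ ξ * kernelSymbol k₂ ξ := by
  set e : ℝ → ℂ := fun s => cexp (((ξ * s : ℝ) : ℂ) * I) with he
  have he_norm : ∀ s, ‖e s‖ = 1 := fun s => norm_cexp_real_mul_I _
  have he_add : ∀ s t, e (s + t) = e s * e t := fun s t => by
    simp only [he, ← Complex.exp_add]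
    congr 1
    push_cast
    ring
  -- integrability of `(s, t) ↦ k₁ t k₂(s - t) e^{iξs}` on `ℝ × ℝ`
  have hconv : Integrable (fun p : ℝ × ℝ => k₁ p.2 * k₂ (p.1 - p.2))
      ((volume : Measure ℝ).prod volume) := by
    have := hk₁.convolution_integrand (ContinuousLinearMap.mul ℂ ℂ) hk₂
    simpa only [ContinuousLinearMap.mul_apply'] using this
  have hint : Integrable (Function.uncurry fun (s t : ℝ) => k₁ t * k₂ (s - t) * e s)
      ((volume : Measure ℝ).prod volume) := by
    refine (hconv.norm).mono' (hconv.aestronglyMeasurable.mul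
      (Continuous.aestronglyMeasurable (by simp only [he]; fun_prop))) (ae_of_all _ fun p => ?_)
    change ‖k₁ p.2 * k₂ (p.1 - p.2) * e p.1‖ ≤ ‖k₁ p.2 * k₂ (p.1 - p.2)‖
    rw [norm_mul, he_norm, mul_one]
  calc kernelSymbol (fun s => ∫ t, k₁ t * k₂ (s - t)) ξ
      = ∫ s, ∫ t, k₁ t * k₂ (s - t) * e s := by
        unfold kernelSymbol
        refine integral_congr_ae (ae_of_all _ fun s => ?_)
        simp only
        rw [← integral_mul_const]
    _ = ∫ t, ∫ s, k₁ t * k₂ (s - t) * e s := integral_integral_swap hint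
    _ = ∫ t, k₁ t * e t * kernelSymbol k₂ ξ := by
        refine integral_congr_ae (ae_of_all _ fun t => ?_)
        simp only
        have hsub : ∫ s, k₁ t * k₂ (s - t) * e s = ∫ s, k₁ t * k₂ s * e (s + t) := by
          rw [← integral_sub_right_eq_self (fun s => k₁ t * k₂ s * e (s + t)) t]
          simp only [sub_add_cancel]
        rw [hsub]
        unfold kernelSymbol
        rw [← integral_const_mul]
        refine integral_congr_ae (ae_of_all _ fun s => ?_)
        simp only [he_add]
        ring
    _ = kernelSymbol k₁ ξ * kernelSymbol k₂ ξ := by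
        unfold kernelSymbol
        rw [← integral_mul_const]

/-! ## §2. The unital algebra of symbol data `(c, k)` -/

/-- **Symbol datum**: a scalar `c` and an integrable kernel `k`, encoding the operator `c·1 + U[k]` of
the unital smeared group algebra and its symbol `c + ǩ` (a Type of data; "`B` has symbol `b`" is the
statement `∃ d, B = d.op U ∧ b = d.fn`, kept inline). [folklore] -/
structure SymbolDatum where
  /-- the scalar part -/
  c : ℂ
  /-- the kernel, an integrable function on `ℝ` -/
  k : ℝ → ℂ
  /-- integrability of the kernel -/
  integrable : Integrable k

namespace SymbolDatum

/-- The operator `c·1 + U[k]` of a symbol datum. [folklore] -/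
def op (d : SymbolDatum) (U : OneParameterUnitaryGroup H) : H →L[ℂ] H :=
  d.c • (1 : H →L[ℂ] H) + U.smear d.k

/-- The symbol `c + ǩ` of a symbol datum. [folklore] -/
def fn (d : SymbolDatum) (ξ : ℝ) : ℂ := d.c + kernelSymbol d.k ξ

/-- The unit datum `(1, 0)`. [folklore] -/
def one : SymbolDatum := ⟨1, 0, integrable_zero _ _ _⟩

/-- Sum of data. [folklore] -/
def add (d₁ d₂ : SymbolDatum) : SymbolDatum :=
  ⟨d₁.c + d₂.c, fun a => d₁.k a + d₂.k a, d₁.integrable.add d₂.integrable⟩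

/-- Scalar multiple of a datum. [folklore] -/
def smul (a : ℂ) (d : SymbolDatum) : SymbolDatum :=
  ⟨a * d.c, fun x => a * d.k x, d.integrable.const_mul a⟩

/-- The cross kernel `c₁ k₂ + c₂ k₁` of a product. [folklore] -/
theorem integrable_cross (d₁ d₂ : SymbolDatum) :
    Integrable fun a => d₁.c * d₂.k a + d₂.c * d₁.k a :=
  (d₂.integrable.const_mul d₁.c).add (d₁.integrable.const_mul d₂.c)

/-- Product of data: `(c₁c₂, c₁k₂ + c₂k₁ + k₁ ⋆ k₂)`. [folklore] -/
def mul (d₁ d₂ : SymbolDatum) : SymbolDatum :=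
  ⟨d₁.c * d₂.c, fun a => (d₁.c * d₂.k a + d₂.c * d₁.k a) + ∫ t, d₁.k t * d₂.k (a - t),
    (integrable_cross d₁ d₂).add (integrable_convolution_kernel d₁.integrable d₂.integrable)⟩

/-- Powers of a datum. [folklore] -/
def pow (d : SymbolDatum) : ℕ → SymbolDatum
  | 0 => one
  | n + 1 => (pow d n).mul d

/-- `U[0] = 0`. [folklore] -/
theorem smear_zero_kernel (U : OneParameterUnitaryGroup H) : U.smear (0 : ℝ → ℂ) = 0 := by
  refine ContinuousLinearMap.ext fun f => ?_
  rw [U.smear_apply (integrable_zero _ _ _)]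
  simp

/-- `U[k₁ + k₂] = U[k₁] + U[k₂]`. [folklore] -/
theorem smear_add (U : OneParameterUnitaryGroup H) {k₁ k₂ : ℝ → ℂ} (hk₁ : Integrable k₁)
    (hk₂ : Integrable k₂) : U.smear (fun a => k₁ a + k₂ a) = U.smear k₁ + U.smear k₂ := by
  refine ContinuousLinearMap.ext fun f => ?_
  rw [U.smear_apply (hk₁.fun_add hk₂), _root_.add_apply, U.smear_apply hk₁, U.smear_apply hk₂]
  exact U.integral_add_smul_appReal hk₁ hk₂ f

/-- `U[c k] = c U[k]`. [folklore] -/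
theorem smear_const_mul (U : OneParameterUnitaryGroup H) (c : ℂ) {k : ℝ → ℂ} (hk : Integrable k) :
    U.smear (fun a => c * k a) = c • U.smear k := by
  refine ContinuousLinearMap.ext fun f => ?_
  rw [U.smear_apply (hk.const_mul c), FunLike.coe_smul, Pi.smul_apply, U.smear_apply hk,
    ← integral_smul]
  simp_rw [mul_smul]

/-- `one.op = 1`. [folklore] -/
theorem op_one (U : OneParameterUnitaryGroup H) : one.op U = (1 : H →L[ℂ] H) := by
  rw [op, one, smear_zero_kernel, one_smul, add_zero]

/-- `one.fn = 1`. [folklore] -/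
theorem fn_one (ξ : ℝ) : one.fn ξ = 1 := by
  simp [fn, one]

/-- `(d₁ + d₂).op = d₁.op + d₂.op`. [folklore] -/
theorem op_add (d₁ d₂ : SymbolDatum) (U : OneParameterUnitaryGroup H) :
    (d₁.add d₂).op U = d₁.op U + d₂.op U := by
  simp only [op, add]
  rw [smear_add U d₁.integrable d₂.integrable, add_smul]
  abel

/-- `(d₁ + d₂).fn = d₁.fn + d₂.fn`. [folklore] -/
theorem fn_add (d₁ d₂ : SymbolDatum) (ξ : ℝ) : (d₁.add d₂).fn ξ = d₁.fn ξ + d₂.fn ξ := by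
  simp only [fn, add]
  rw [kernelSymbol_add d₁.integrable d₂.integrable]
  ring

/-- `(a d).op = a d.op`. [folklore] -/
theorem op_smul (a : ℂ) (d : SymbolDatum) (U : OneParameterUnitaryGroup H) :
    (smul a d).op U = a • d.op U := by
  simp only [op, smul]
  rw [smul_add, smul_smul, smear_const_mul U a d.integrable]

/-- `(a d).fn = a d.fn`. [folklore] -/
theorem fn_smul (a : ℂ) (d : SymbolDatum) (ξ : ℝ) : (smul a d).fn ξ = a * d.fn ξ := by
  simp only [fn, smul]
  rw [kernelSymbol_smul, mul_add]

/-- **`(d₁ d₂).op = d₁.op d₂.op`** (`(c₁ + U[k₁])(c₂ + U[k₂]) = c₁c₂ + U[c₁k₂ + c₂k₁ + k₁ ⋆ k₂]`).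
[folklore] -/
theorem op_mul (d₁ d₂ : SymbolDatum) (U : OneParameterUnitaryGroup H) :
    (d₁.mul d₂).op U = d₁.op U * d₂.op U := by
  have hk12 := integrable_convolution_kernel d₁.integrable d₂.integrable
  simp only [op, mul]
  rw [smear_add U (integrable_cross d₁ d₂) hk12,
    smear_add U (d₂.integrable.const_mul d₁.c) (d₁.integrable.const_mul d₂.c),
    smear_const_mul U d₁.c d₂.integrable, smear_const_mul U d₂.c d₁.integrable,
    ← smear_mul_smear U d₁.integrable d₂.integrable]
  simp only [mul_add, add_mul, smul_mul_assoc, mul_smul_comm, one_mul, mul_one, smul_add, smul_smul]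
  rw [mul_comm d₂.c d₁.c]
  abel

/-- **`(d₁ d₂).fn = d₁.fn d₂.fn`** (the convolution theorem). [folklore] -/
theorem fn_mul (d₁ d₂ : SymbolDatum) (ξ : ℝ) : (d₁.mul d₂).fn ξ = d₁.fn ξ * d₂.fn ξ := by
  have hk12 := integrable_convolution_kernel d₁.integrable d₂.integrable
  simp only [fn, mul]
  rw [kernelSymbol_add (integrable_cross d₁ d₂) hk12,
    kernelSymbol_add (d₂.integrable.const_mul d₁.c) (d₁.integrable.const_mul d₂.c),
    kernelSymbol_smul, kernelSymbol_smul, kernelSymbol_convolution d₁.integrable d₂.integrable]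
  ring

/-- `(dⁿ).op = (d.op)ⁿ`. [folklore] -/
theorem op_pow (d : SymbolDatum) (U : OneParameterUnitaryGroup H) :
    ∀ n : ℕ, (d.pow n).op U = d.op U ^ n
  | 0 => by rw [pow, op_one, pow_zero]
  | n + 1 => by rw [pow, op_mul, op_pow d U n, pow_succ]

/-- `(dⁿ).fn = (d.fn)ⁿ`. [folklore] -/
theorem fn_pow (d : SymbolDatum) (ξ : ℝ) : ∀ n : ℕ, (d.pow n).fn ξ = d.fn ξ ^ n
  | 0 => by rw [pow, fn_one, pow_zero]
  | n + 1 => by rw [pow, fn_mul, fn_pow d ξ n, pow_succ]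

/-- **Symbols are continuous.** [folklore] -/
theorem continuous_fn (d : SymbolDatum) : Continuous d.fn :=
  continuous_const.add (continuous_kernelSymbol d.integrable)

/-- **Symbols are bounded**: `‖d.fn ξ‖ ≤ ‖c‖ + ‖k‖₁`. [folklore] -/
theorem norm_fn_le (d : SymbolDatum) (ξ : ℝ) : ‖d.fn ξ‖ ≤ ‖d.c‖ + ∫ a, ‖d.k a‖ :=
  (norm_add_le _ _).trans (by gcongr; exact norm_kernelSymbol_le d.k ξ)

/-- A symbol is integrable against every spectral measure. [folklore] -/
theorem integrable_fn (d : SymbolDatum) (U : OneParameterUnitaryGroup H) (v : H) :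
    Integrable d.fn (specMeasure U v) :=
  Integrable.of_bound (C := ‖d.c‖ + ∫ a, ‖d.k a‖) d.continuous_fn.aestronglyMeasurable
    (ae_of_all _ d.norm_fn_le)

/-- **Diagonal matrix elements through the symbol**: `⟪v, d.op v⟫ = ∫ d.fn dμ_v`. [folklore] -/
theorem inner_op_eq (d : SymbolDatum) (U : OneParameterUnitaryGroup H) (v : H) :
    ⟪v, d.op U v⟫_ℂ = ∫ ξ, d.fn ξ ∂(specMeasure U v) := by
  have hint : Integrable (kernelSymbol d.k) (specMeasure U v) :=
    Integrable.of_bound (C := ∫ a, ‖d.k a‖) (continuous_kernelSymbol d.integrable).aestronglyMeasurable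
      (ae_of_all _ fun ξ => norm_kernelSymbol_le d.k ξ)
  have e1 : ⟪v, d.op U v⟫_ℂ =
      d.c * ((‖v‖ : ℂ) ^ 2) + ∫ ξ, kernelSymbol d.k ξ ∂(specMeasure U v) := by
    rw [op, _root_.add_apply, inner_add_right, FunLike.coe_smul, Pi.smul_apply,
      one_apply_eq_self, inner_smul_right, inner_self_eq_norm_sq_to_K,
      inner_smear_eq_integral_specMeasure U d.integrable v]
    rfl
  have e2 : ∫ ξ, d.fn ξ ∂(specMeasure U v) =
      ((‖v‖ ^ 2 : ℝ) : ℂ) * d.c + ∫ ξ, kernelSymbol d.k ξ ∂(specMeasure U v) := by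
    simp only [fn]
    rw [integral_add (integrable_const d.c) hint, integral_const, specMeasure_real_univ,
      Complex.real_smul]
  rw [e1, e2]
  push_cast
  ring

end SymbolDatum

/-! ## §3. Headline (registered helper stub) -/

/-- **Spectral side of the unital smeared group algebra, headline form** (all binders explicit;
registered helper stub of `stub_mourreThresholdLAP`): for a scalar `c`, an integrable kernel `k` and
every vector `v`, `⟪v, (c·1 + U[k]) v⟫ = ∫ (c + ǩ(ξ)) dμ_v(ξ)` with `ǩ(ξ) = ∫ k(a) e^{iξa} da` and
`μ_v` the Stone–Bochner measure of `v`. [folklore] -/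
theorem inner_smearAlgebra_eq_integral_symbol :
    ∀ (K : Type) [NormedAddCommGroup K] [InnerProductSpace ℂ K] [CompleteSpace K]
      (U : Literature.Analysis.UnboundedOperators.OneParameterUnitaryGroup K) (c : ℂ) (k : ℝ → ℂ)
      (hk : MeasureTheory.Integrable k MeasureTheory.volume) (v : K),
      @inner ℂ K _ v ((c • (1 : K →L[ℂ] K) + U.smear k) v) =
        MeasureTheory.integral
          (Summit.AtomisticToContinuum.FouriersLaw.Theorems.MourreDissolution.specMeasure U v)
          fun ξ : ℝ =>
            c + Summit.AtomisticToContinuum.FouriersLaw.Theorems.MourreDissolution.kernelSymbol k ξ := by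
  intro K _ _ _ U c k hk v
  exact SymbolDatum.inner_op_eq ⟨c, k, hk⟩ U v

end Summit.AtomisticToContinuum.FouriersLaw.Theorems.MourreDissolution
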